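import Mathlib
import Summits.AtomisticToContinuum.HydrodynamicLimit.Theorems.ImplosionDichotomyDenseExcursionCavityNegExpFuchs
import Summits.AtomisticToContinuum.HydrodynamicLimit.Theorems.ImplosionDichotomyDenseExcursionCavityMatchingReal
import Summits.AtomisticToContinuum.HydrodynamicLimit.Theorems.ImplosionDichotomyDenseExcursionSonicCavityResolventExponent

/-!
# Pointwise existence of the smooth centre-regular resolvent solution for exponents `Re ν(Λ) ≤ −1` (theorem T6b, part 2)
# (crux `DenseExcursion`, line `sonic-cavity-renewal`, bricks for stub `stub_cavityResolventCk`)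

Helper file (`--supports stmt-AtomisticToContinuum-12586`, line lead a2, stub-worker E1 for `stub_cavityResolventCk`,
theorem T6 of its decomposition). Registered helpers:

* `sonic_smooth_branch_negexp` — THE SMOOTH BRANCH AT THE REPULSIVE SONIC POINT FOR `Re ν(Λ) ≤ −1`, IN RESOLVENT FORM:
  for a monatomic tube profile and `Λ` with `Re ν(Λ) ≤ −1` (`ν(Λ) = (b₊₊(0) − Λ)/κ`) there is `δ > 0` such that for all
  `C^∞` sources and every `q₀` the resolvent equation `Λŵ − linW = f`, `Λŝ − linS = g` has a `C^∞` solution on `(−δ, δ)`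
  with `ŵ(0) − 3ŝ(0) = q₀`. The characteristic system `c₊ p′ = (Λ − b₊₊)p − b₊₋q − σ_p`, `c₋ q′ = −b₋₊p + (Λ − b₋₋)q − σ_q`
  (`c₊ = x·η`) divided by `η`, `c₋` is the first-kind singular system of `fuchs_branch_of_re_le_neg_one` with
  `a₁₁ = (Λ − b₊₊)/η`, `a₁₁(0) = ν(Λ)`; its `q`-row is regular, so no continuity argument at `x = 0` is needed. The smooth
  inverse speeds `1/η`, `1/c₋` come from `sonic_frobenius_pair` (its `Λ`-independent part), the coefficients are cut
  off to global smooth functions (`exists_contDiff_eq_on_Icc`) before `fuchs_branch_of_re_le_neg_one` is applied.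
* `cavity_resolvent_pointwise_negexp` (T6b, part 2) — POINTWISE EXISTENCE FOR EVERY `Λ` OF THE REGION WITH
  `Re ν(Λ) ≤ −1`, i.e. `Re Λ ≥ b₊₊(0) + κ`: this contains all the apparent resonances `ν(Λ) = −m`, `m ≥ 1`, left open by
  `cavity_resolvent_pointwise_nonint`. Assembly by `cavity_resolvent_of_local` (the homogeneous branch with `q(0) = 1` is
  non-trivial at `0`). Together the two theorems give existence on the whole region except the four jet resonances
  `ν(Λ) ∈ {0, 1, 2, 3}` (and the empty set `ν ∈ (−1, 0) ∩ ℤ`);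
* `cavity_resolvent_pointwise_offres` (T6 minus the jet resonances) — THE SINGLE ENTRY POINT: existence for every `Λ` of the
  region with `ν(Λ) ∉ {0, 1, 2, 3}` (case split `ν ∉ ℤ` / `ν = m ≤ −1` / `ν = m ≥ 4`, the last being empty on the window:
  `Re ν ≤ (4 + 1/5 − 2r − κ)/κ < 4` by `sonic_order_zero_coefficient`, `κ ≥ 2/5`, `r ≥ 17307/15625`).

Sources: folklore (Coddington–Levinson 1955 Ch. 4). Everything proved; no new definitions.
-/

noncomputable section

open Set Filter
open scoped Topology ContDiff

namespace Summit.AtomisticToContinuum.HydrodynamicLimit.Theorems.SonicCavityRenewal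

open Summit.AtomisticToContinuum.HydrodynamicLimit.Theorems.R2OneModeTwoConditions

/-! ## The smooth branch for `Re ν ≤ −1` in resolvent form -/

/-- **Registered helper `sonic_smooth_branch_negexp`: THE SMOOTH BRANCH AT THE REPULSIVE SONIC POINT FOR EXPONENTS
`Re ν(Λ) ≤ −1`, IN RESOLVENT FORM.** See the module docstring. [folklore] -/
theorem sonic_smooth_branch_negexp : ∀ (r : ℝ) (W S : ℝ → ℝ), IsMonatomicProfile r W S → CavityTube r W S → ∀ Λ : ℂ, ((((2 / 3 * deriv W 0 + 2 * deriv S 0 + 2 * W 0 + 4 * S 0 - r : ℝ) : ℂ) - Λ) / ((-(deriv W 0 + deriv S 0) : ℝ) : ℂ)).re ≤ -1 → ∃ δ > 0, ∀ (f g : ℝ → ℂ), ContDiff ℝ ∞ f → ContDiff ℝ ∞ g → ∀ q₀ : ℂ, ∃ ŵ ŝ : ℝ → ℂ, ContDiffOn ℝ ∞ ŵ (Set.Ioo (-δ) δ) ∧ ContDiffOn ℝ ∞ ŝ (Set.Ioo (-δ) δ) ∧ ŵ 0 - 3 * ŝ 0 = q₀ ∧ ∀ x ∈ Set.Ioo (-δ)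 δ, Λ * ŵ x - linW r W S ŵ ŝ x = f x ∧ Λ * ŝ x - linS r W S ŵ ŝ x = g x := by
  intro r W S hP hT Λ hν
  obtain ⟨ρ, hρ, -, hxη, hη0, hκ, -, hne, -, -, ⟨ι₁, ι₂, hι₁, hι₂, hιeq, -⟩, -⟩ := sonic_frobenius_pair r W S hP hT 0 0
  obtain ⟨-, -, hW, hS, -, -⟩ := hP
  have hW' : ContDiff ℝ ∞ (deriv W) := (contDiff_infty_iff_deriv.1 hW).2
  have hS' : ContDiff ℝ ∞ (deriv S) := (contDiff_infty_iff_deriv.1 hS).2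
  set ν : ℂ := ((((2 / 3 * deriv W 0 + 2 * deriv S 0 + 2 * W 0 + 4 * S 0 - r : ℝ) : ℂ) - Λ) /
    ((-(deriv W 0 + deriv S 0) : ℝ) : ℂ)) with hνdef
  have hU : IsOpen (Ioo (-ρ) ρ) := isOpen_Ioo
  have h0U : (0 : ℝ) ∈ Ioo (-ρ) ρ := ⟨by linarith, hρ⟩
  -- the real coefficient combinations, as smooth complex functions
  set Bpp : ℝ → ℂ := fun x => ((2 / 3 * deriv W x + 2 * W x - r + 2 * deriv S x + 4 * S x : ℝ) : ℂ) with hBpp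
  set Bpm : ℝ → ℂ := fun x => ((deriv W x / 3 + deriv S x + 2 * S x : ℝ) : ℂ) with hBpm
  set Bmp : ℝ → ℂ := fun x => ((deriv W x / 3 - deriv S x - 2 * S x : ℝ) : ℂ) with hBmp
  set Bmm : ℝ → ℂ := fun x => ((2 / 3 * deriv W x + 2 * W x - r - 2 * deriv S x - 4 * S x : ℝ) : ℂ) with hBmm
  have sBpp : ContDiff ℝ ∞ Bpp := Complex.ofRealCLM.contDiff.comp (((((contDiff_const.mul hW').add
    (contDiff_const.mul hW)).sub contDiff_const).add (contDiff_const.mul hS')).add (contDiff_const.mul hS))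
  have sBpm : ContDiff ℝ ∞ Bpm := Complex.ofRealCLM.contDiff.comp (((hW'.div_const 3).add hS').add (contDiff_const.mul hS))
  have sBmp : ContDiff ℝ ∞ Bmp := Complex.ofRealCLM.contDiff.comp (((hW'.div_const 3).sub hS').sub (contDiff_const.mul hS))
  have sBmm : ContDiff ℝ ∞ Bmm := Complex.ofRealCLM.contDiff.comp (((((contDiff_const.mul hW').add
    (contDiff_const.mul hW)).sub contDiff_const).sub (contDiff_const.mul hS')).sub (contDiff_const.mul hS))
  -- the coefficient functions of the first-kind singular system on `(−ρ, ρ)`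
  set n₁₁ : ℝ → ℂ := fun x => (Λ - Bpp x) * ι₁ x with hn₁₁
  set n₁₂ : ℝ → ℂ := fun x => -Bpm x * ι₁ x with hn₁₂
  set m₂₁ : ℝ → ℂ := fun x => -Bmp x * ι₂ x with hm₂₁
  set m₂₂ : ℝ → ℂ := fun x => (Λ - Bmm x) * ι₂ x with hm₂₂
  have sn₁₁ : ContDiffOn ℝ ∞ n₁₁ (Ioo (-ρ) ρ) := (contDiffOn_const.sub sBpp.contDiffOn).mul hι₁
  have sn₁₂ : ContDiffOn ℝ ∞ n₁₂ (Ioo (-ρ) ρ) := sBpm.contDiffOn.neg.mul hι₁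
  have sm₂₁ : ContDiffOn ℝ ∞ m₂₁ (Ioo (-ρ) ρ) := sBmp.contDiffOn.neg.mul hι₂
  have sm₂₂ : ContDiffOn ℝ ∞ m₂₂ (Ioo (-ρ) ρ) := (contDiffOn_const.sub sBmm.contDiffOn).mul hι₂
  -- the exponent: `n₁₁(0) = ν`
  have hsum0 : deriv W 0 + deriv S 0 ≠ 0 := by linarith
  have hn0 : n₁₁ 0 = ν := by
    obtain ⟨i1, -⟩ := hιeq 0 h0U
    have hs' : ((deriv W 0 : ℝ) : ℂ) + ((deriv S 0 : ℝ) : ℂ) ≠ 0 := by exact_mod_cast hsum0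
    simp only [hn₁₁, hνdef, hBpp, i1, hη0]
    push_cast
    field_simp
    ring
  -- globalisation of the coefficients on `[−ρ/2, ρ/2]`
  have hρ2 : (0 : ℝ) < ρ / 2 := by linarith
  have hρ2' : ρ / 2 < ρ := by linarith
  obtain ⟨A₁₁, hA₁₁, eA₁₁⟩ := exists_contDiff_eq_on_Icc hρ2 hρ2' sn₁₁
  obtain ⟨A₁₂, hA₁₂, eA₁₂⟩ := exists_contDiff_eq_on_Icc hρ2 hρ2' sn₁₂
  obtain ⟨A₂₁, hA₂₁, eA₂₁⟩ := exists_contDiff_eq_on_Icc hρ2 hρ2' sm₂₁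
  obtain ⟨A₂₂, hA₂₂, eA₂₂⟩ := exists_contDiff_eq_on_Icc hρ2 hρ2' sm₂₂
  have h0I : (0 : ℝ) ∈ Icc (-(ρ / 2)) (ρ / 2) := ⟨by linarith, by linarith⟩
  have hA0 : A₁₁ 0 = ν := (eA₁₁ h0I).trans hn0
  obtain ⟨δ₀, hδ₀, hfuchs⟩ := fuchs_branch_of_re_le_neg_one ν A₁₁ A₁₂ A₂₁ A₂₂ hν hA₁₁ hA₁₂ hA₂₁ hA₂₂ hA0
  set δ : ℝ := min δ₀ (ρ / 2) with hδ
  have hδpos : 0 < δ := lt_min hδ₀ hρ2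
  have hsub₀ : Ioo (-δ) δ ⊆ Ioo (-δ₀) δ₀ := Ioo_subset_Ioo (neg_le_neg (min_le_left _ _)) (min_le_left _ _)
  have hsubI : Ioo (-δ) δ ⊆ Icc (-(ρ / 2)) (ρ / 2) := fun x hx =>
    ⟨by linarith [hx.1, min_le_right δ₀ (ρ / 2)], by linarith [hx.2, min_le_right δ₀ (ρ / 2)]⟩
  have hsubρ : Ioo (-δ) δ ⊆ Ioo (-ρ) ρ := fun x hx => ⟨by linarith [(hsubI hx).1], by linarith [(hsubI hx).2]⟩
  refine ⟨δ, hδpos, fun f g hf hg q₀ => ?_⟩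
  -- the sources `τ₁ = −σ_p ι₁`, `τ₂ = −σ_q ι₂`, globalised
  have sτ₁ : ContDiffOn ℝ ∞ (fun x => -(f x + 3 * g x) * ι₁ x) (Ioo (-ρ) ρ) :=
    (hf.add (contDiff_const.mul hg)).contDiffOn.neg.mul hι₁
  have sτ₂ : ContDiffOn ℝ ∞ (fun x => -(f x - 3 * g x) * ι₂ x) (Ioo (-ρ) ρ) :=
    (hf.sub (contDiff_const.mul hg)).contDiffOn.neg.mul hι₂
  obtain ⟨T₁, hT₁, eT₁⟩ := exists_contDiff_eq_on_Icc hρ2 hρ2' sτ₁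
  obtain ⟨T₂, hT₂, eT₂⟩ := exists_contDiff_eq_on_Icc hρ2 hρ2' sτ₂
  obtain ⟨p, q, hp, hq, hq0, hpq⟩ := hfuchs T₁ T₂ hT₁ hT₂ q₀
  have hpδ : ContDiffOn ℝ ∞ p (Ioo (-δ) δ) := hp.mono hsub₀
  have hqδ : ContDiffOn ℝ ∞ q (Ioo (-δ) δ) := hq.mono hsub₀
  have hdf : ∀ {φ : ℝ → ℂ}, ContDiffOn ℝ ∞ φ (Ioo (-δ) δ) → ∀ y ∈ Ioo (-δ) δ, HasDerivAt φ (deriv φ y) y :=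
    fun hφ y hy => ((hφ.differentiableOn (by simp)) y hy |>.differentiableAt (isOpen_Ioo.mem_nhds hy)).hasDerivAt
  -- the characteristic system on `(−δ, δ)`
  have hchar : ∀ x ∈ Ioo (-δ) δ,
      ((W x - 1 + S x : ℝ) : ℂ) * deriv p x = (Λ - ((2 / 3 * deriv W x + 2 * W x - r + 2 * deriv S x + 4 * S x : ℝ) : ℂ)) *
        p x - ((deriv W x / 3 + deriv S x + 2 * S x : ℝ) : ℂ) * q x - (f x + 3 * g x) ∧
      ((W x - 1 - S x : ℝ) : ℂ) * deriv q x = -((deriv W x / 3 - deriv S x - 2 * S x : ℝ) : ℂ) * p x +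
        (Λ - ((2 / 3 * deriv W x + 2 * W x - r - 2 * deriv S x - 4 * S x : ℝ) : ℂ)) * q x - (f x - 3 * g x) := by
    intro x hx
    have hxI := hsubI hx
    have hxρ := hsubρ hx
    obtain ⟨e1, e2⟩ := hpq x (hsub₀ hx)
    rw [eA₁₁ hxI, eA₁₂ hxI, eT₁ hxI] at e1
    rw [eA₂₁ hxI, eA₂₂ hxI, eT₂ hxI] at e2
    obtain ⟨i1, i2⟩ := hιeq x hxρ
    obtain ⟨hηx, hcmx⟩ := hne x hxρ
    have hinv₁ : ((dslope (fun y => W y - 1 + S y) 0 x : ℝ) : ℂ) * ι₁ x = 1 := by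
      have hηC : ((dslope (fun y => W y - 1 + S y) 0 x : ℝ) : ℂ) ≠ 0 := Complex.ofReal_ne_zero.2 hηx
      rw [i1]; push_cast at hηC ⊢; field_simp
    have hinv₂ : ((W x - 1 - S x : ℝ) : ℂ) * ι₂ x = 1 := by
      have hc : ((W x - 1 - S x : ℝ) : ℂ) ≠ 0 := Complex.ofReal_ne_zero.2 hcmx.ne
      rw [i2]; push_cast at hc ⊢; field_simp
    have hcp : ((W x - 1 + S x : ℝ) : ℂ) = (x : ℂ) * ((dslope (fun y => W y - 1 + S y) 0 x : ℝ) : ℂ) := by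
      rw [← hxη x]; push_cast; ring
    simp only [hn₁₁, hn₁₂, hBpp, hBpm] at e1
    simp only [hm₂₁, hm₂₂, hBmp, hBmm] at e2
    constructor
    · rw [hcp]
      linear_combination ((dslope (fun y => W y - 1 + S y) 0 x : ℝ) : ℂ) * e1 +
        ((Λ - ((2 / 3 * deriv W x + 2 * W x - r + 2 * deriv S x + 4 * S x : ℝ) : ℂ)) * p x -
          ((deriv W x / 3 + deriv S x + 2 * S x : ℝ) : ℂ) * q x - (f x + 3 * g x)) * hinv₁
    · linear_combination ((W x - 1 - S x : ℝ) : ℂ) * e2 +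
        (-((deriv W x / 3 - deriv S x - 2 * S x : ℝ) : ℂ) * p x +
          (Λ - ((2 / 3 * deriv W x + 2 * W x - r - 2 * deriv S x - 4 * S x : ℝ) : ℂ)) * q x - (f x - 3 * g x)) * hinv₂
  -- back to `(ŵ, ŝ)`
  refine ⟨fun x => (p x + q x) / 2, fun x => (p x - q x) / 6, (hpδ.add hqδ).div_const _, (hpδ.sub hqδ).div_const _,
    by simp only; rw [hq0]; ring, fun x hx => ?_⟩
  have dw : deriv (fun x => (p x + q x) / 2) x = (deriv p x + deriv q x) / 2 :=
    (((hdf hpδ x hx).add (hdf hqδ x hx)).div_const 2).deriv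
  have ds : deriv (fun x => (p x - q x) / 6) x = (deriv p x - deriv q x) / 6 :=
    (((hdf hpδ x hx).sub (hdf hqδ x hx)).div_const 6).deriv
  refine (lin_iff_char r W S Λ (fun x => (p x + q x) / 2) (fun x => (p x - q x) / 6) (f x) (g x) x).2 ?_
  rw [dw, ds]
  obtain ⟨e1, e2⟩ := hchar x hx
  constructor
  · have h1 : (deriv p x + deriv q x) / 2 + 3 * ((deriv p x - deriv q x) / 6) = deriv p x := by ring
    have h2 : (p x + q x) / 2 + 3 * ((p x - q x) / 6) = p x := by ring
    have h3 : (p x + q x) / 2 - 3 * ((p x - q x) / 6) = q x := by ring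
    rw [h1, h2, h3]; exact e1
  · have h1 : (deriv p x + deriv q x) / 2 - 3 * ((deriv p x - deriv q x) / 6) = deriv q x := by ring
    have h2 : (p x + q x) / 2 + 3 * ((p x - q x) / 6) = p x := by ring
    have h3 : (p x + q x) / 2 - 3 * ((p x - q x) / 6) = q x := by ring
    rw [h1, h2, h3]; exact e2

/-! ## T6b, part 2: pointwise existence for `Re ν(Λ) ≤ −1` -/

/-- **Registered helper `cavity_resolvent_pointwise_negexp` (T6b, part 2): POINTWISE EXISTENCE OF THE SMOOTH CENTRE-REGULAR
RESOLVENT SOLUTION FOR EVERY `Λ` OF THE REGION WITH `Re ν(Λ) ≤ −1`.** On the pinned window, under the stub's hypotheses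
and for the window rate `Λ₁` carrying a smooth radial mode: for every `Λ` with `Re Λ ≥ −1/5` outside the `1/20`-discs
around `0`, `Λ₁`, `r`, with `Re ν(Λ) ≤ −1`, and every regular source `(f, g)`, the resolvent equation has a smooth
centre-regular solution on `ℝ` (local data from `sonic_smooth_branch_negexp`, assembly by `cavity_resolvent_of_local`).
The hypotheses `17307/15625 ≤ r` and `OrigProfileEqs` are carried for uniformity but not used. [folklore] -/
theorem cavity_resolvent_pointwise_negexp : ∀ (r : ℝ) (W S : ℝ → ℝ), (17307 / 15625 : ℝ) ≤ r → r ≤ 697 / 625 → IsMonatomicProfile r W S → OrigProfileEqs r W S → CavityTube r W S → BoxPackage r W S → RealBound r W S → SonicConfinement r W S → ∀ Λ₁ : ℝ, 6 * (r - 1) < Λ₁ → Λ₁ < 9 * (r - 1) → (∃ ŵ ŝ : ℝ → ℂ, IsSmoothRadialMode r W S (Λ₁ : ℂ) ŵ ŝ) → ∀ Λ : ℂ, -(1 / 5 : ℝ) ≤ Λ.re → (1 / 20 : ℝ) ≤ ‖Λ‖ → (1 / 20 : ℝ) ≤ ‖Λ - (Λ₁ : ℂ)‖ → (1 / 20 :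 ℝ) ≤ ‖Λ - (r : ℂ)‖ → ((((2 / 3 * deriv W 0 + 2 * deriv S 0 + 2 * W 0 + 4 * S 0 - r : ℝ) : ℂ) - Λ) / ((-(deriv W 0 + deriv S 0) : ℝ) : ℂ)).re ≤ -1 → ∀ (f g : ℝ → ℂ), IsRegularPair f g → ∃ ŵ ŝ : ℝ → ℂ, IsRegularPair ŵ ŝ ∧ ∀ x, Λ * ŵ x - linW r W S ŵ ŝ x = f x ∧ Λ * ŝ x - linS r W S ŵ ŝ x = g x := by
  intro r W S _ h2 hP _ hT hbox hre him Λ₁ h6 h9 hmode Λ hΛre hΛ0 hΛ1 hΛr hν f g hfg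
  have h2' : r ≤ 89409 / 80000 := h2.trans (by norm_num)
  obtain ⟨δ₀, hδ₀, hloc⟩ := sonic_smooth_branch_negexp r W S hP hT Λ hν
  obtain ⟨ph, qh, hph, hqh, hq1, hsolh⟩ := hloc (fun _ => 0) (fun _ => 0) contDiff_const contDiff_const 1
  obtain ⟨pp, qp, hpp, hqp, -, hsolp⟩ := hloc f g hfg.1 hfg.2.1 0
  set δ : ℝ := min δ₀ 1 with hδ
  have hδpos : 0 < δ := lt_min hδ₀ one_pos
  have hsub : Ioo (-δ) δ ⊆ Ioo (-δ₀) δ₀ := Ioo_subset_Ioo (neg_le_neg (min_le_left _ _)) (min_le_left _ _)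
  have hne0 : ph 0 ≠ 0 ∨ qh 0 ≠ 0 := by
    by_contra h
    push Not at h
    rw [h.1, h.2, mul_zero, sub_zero] at hq1
    exact zero_ne_one hq1
  exact cavity_resolvent_of_local r W S h2' hP hT hbox hre him Λ₁ h6 h9 hmode Λ hΛre hΛ0 hΛ1 hΛr δ hδpos
    (min_le_right _ _) ⟨ph, qh, hph.mono hsub, hqh.mono hsub, fun x hx => hsolh x (hsub hx), 0, ⟨by linarith, hδpos⟩,
    hne0⟩ f g hfg ⟨pp, qp, hpp.mono hsub, hqp.mono hsub, fun x hx => hsolp x (hsub hx)⟩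

/-! ## T6 minus the jet resonances: the single entry point -/

/-- **Registered helper `cavity_resolvent_pointwise_offres` (T6 off the jet resonances): POINTWISE EXISTENCE OF THE SMOOTH
CENTRE-REGULAR RESOLVENT SOLUTION FOR EVERY `Λ` OF THE REGION WHOSE FROBENIUS EXPONENT IS NOT ONE OF `0, 1, 2, 3`.** On the
pinned window, under the stub's hypotheses and for the window rate `Λ₁` carrying a smooth radial mode: for every `Λ` with
`Re Λ ≥ −1/5` outside the `1/20`-discs around `0`, `Λ₁`, `r`, with `ν(Λ) ≠ m` for `m ∈ {0, 1, 2, 3}`, and every regular source,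
the resolvent equation has a smooth centre-regular solution on `ℝ` (`cavity_resolvent_pointwise_nonint` if `ν ∉ ℤ`,
`cavity_resolvent_pointwise_negexp` if `ν = m ≤ −1`; `ν = m ≥ 4` is impossible on the window since
`Re ν ≤ (21/5 − 2r − κ)/κ < 4`). [folklore] -/
theorem cavity_resolvent_pointwise_offres : ∀ (r : ℝ) (W S : ℝ → ℝ), (17307 / 15625 : ℝ) ≤ r → r ≤ 697 / 625 → IsMonatomicProfile r W S → OrigProfileEqs r W S → CavityTube r W S → BoxPackage r W S → RealBound r W S → SonicConfinement r W S → ∀ Λ₁ : ℝ, 6 * (r - 1) < Λ₁ → Λ₁ < 9 * (r - 1) → (∃ ŵ ŝ : ℝ → ℂ, IsSmoothRadialMode r W S (Λ₁ : ℂ) ŵ ŝ) → ∀ Λ : ℂ, -(1 / 5 : ℝ) ≤ Λ.re → (1 / 20 : ℝ) ≤ ‖Λ‖ → (1 / 20 : ℝ) ≤ ‖Λ - (Λ₁ : ℂ)‖ → (1 / 20 : ℝ) ≤ ‖Λ - (r : ℂ)‖ → (∀ m : ℕ, m ≤ 3 → ((((2 / 3 * deriv W 0 + 2 * deriv S 0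 + 2 * W 0 + 4 * S 0 - r : ℝ) : ℂ) - Λ) / ((-(deriv W 0 + deriv S 0) : ℝ) : ℂ)) ≠ (m : ℂ)) → ∀ (f g : ℝ → ℂ), IsRegularPair f g → ∃ ŵ ŝ : ℝ → ℂ, IsRegularPair ŵ ŝ ∧ ∀ x, Λ * ŵ x - linW r W S ŵ ŝ x = f x ∧ Λ * ŝ x - linS r W S ŵ ŝ x = g x := by
  intro r W S h1 h2 hP hE hT hbox hre him Λ₁ h6 h9 hmode Λ hΛre hΛ0 hΛ1 hΛr hres f g hfg
  have h2' : r ≤ 89409 / 80000 := h2.trans (by norm_num)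
  set ν : ℂ := ((((2 / 3 * deriv W 0 + 2 * deriv S 0 + 2 * W 0 + 4 * S 0 - r : ℝ) : ℂ) - Λ) /
    ((-(deriv W 0 + deriv S 0) : ℝ) : ℂ)) with hνdef
  by_cases hint : ∃ m : ℤ, ν = (m : ℂ)
  · obtain ⟨m, hm⟩ := hint
    have hνre : ν.re = (m : ℝ) := by rw [hm]; simp
    rcases le_or_gt m (-1) with hneg | hpos
    · -- apparent resonance: `Re ν = m ≤ -1`
      have hle : ν.re ≤ -1 := by rw [hνre]; exact_mod_cast hneg
      exact cavity_resolvent_pointwise_negexp r W S h1 h2 hP hE hT hbox hre him Λ₁ h6 h9 hmode Λ hΛre hΛ0 hΛ1 hΛr hle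
        f g hfg
    · exfalso
      have hm0 : 0 ≤ m := by omega
      obtain ⟨n, rfl⟩ := Int.eq_ofNat_of_zero_le hm0
      rcases le_or_gt n 3 with hn3 | hn4
      · exact hres n hn3 (by rw [hm]; simp)
      · -- `ν = n ≥ 4` is impossible on the window
        obtain ⟨hb, ⟨hκ, -⟩, -⟩ := sonic_order_zero_coefficient r W S h2' hP hE hT
        have hn4' : (4 : ℝ) ≤ n := by exact_mod_cast hn4
        have hκpos : 0 < -(deriv W 0 + deriv S 0) := by linarith
        have hre_eq : ν.re = ((2 / 3 * deriv W 0 + 2 * deriv S 0 + 2 * W 0 + 4 * S 0 - r) - Λ.re) /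
            (-(deriv W 0 + deriv S 0)) := by
          rw [hνdef, Complex.div_ofReal_re, Complex.sub_re, Complex.ofReal_re]
        have h4 : (4 : ℝ) ≤ ν.re := by rw [hνre]; push_cast; exact hn4'
        rw [hre_eq, le_div_iff₀ hκpos, hb] at h4
        nlinarith
  · push Not at hint
    exact cavity_resolvent_pointwise_nonint r W S h1 h2 hP hE hT hbox hre him Λ₁ h6 h9 hmode Λ hΛre hΛ0 hΛ1 hΛr hint f g hfg

end Summit.AtomisticToContinuum.HydrodynamicLimit.Theorems.SonicCavityRenewal

end
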